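import Literature.Analysis.FluidPDE.DEIJShearStage
import HarnessLib

/-!
# One stage of the Drivas–Elgindi–Iyer–Jeong cascade: phase averaging, the choice of a good
# phase, and the growth inequalities of one smoothed-sawtooth shear

Proof-support file for the discharge of `deij_anomalous_dissipation_eventually`
(`TurbPassiveScalar`), continuing `DEIJShearStage`; everything here is proved, the only
definition is the packaging `DEIJ.slopeProfile` of the slope wave `w_ε` as a `ShearProfile`.

One stage of the cascade shears a smooth scalar `g` on `T^d` by
`Φ_b(x) = x - b s S_ε(N x_q + ϑ) e_p` (`DEIJ.stageProfile`, amplitude `b ≥ 0`, sign `s = ±1`,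
integer frequency `N`, phase `ϑ`). [cite: DrivasEtAl2022, §3.1–3.3]

* `DEIJ.onCircle_D_stageProfile`, `DEIJ.onCircle_D_D_stageProfile`: slope and curvature of the
  stage profile on the circle, `c N w_ε(N•z + ϑ)` and `c N² w_ε'(N•z + ϑ)`.
* `DEIJ.integral_integral_comp_nsmul_add_mul` (**phase averaging**): for continuous `F` on `T¹`
  and `ρ` on `T^d`, `∫_{ϑ∈T¹} ∫_x F(N•x_q + ϑ) ρ(x) = (∫_{T¹} F)(∫ ρ)` (Fubini and translation
  invariance); with `∫_{T¹}(1 - w_ε²) ≤ 4ε`, `∫_{T¹}(w_ε')² ≤ 16C_ψ²/ε`.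
* `DEIJ.exists_good_phase`: for smooth `g` some phase `ϑ` has corner defect
  `∫(1 - w_ε(N x_q+ϑ)²)(∂_p g)² ≤ 8ε‖∂_p g‖²` and curvature weight
  `∫ w_ε'(N x_q+ϑ)²‖∇g‖² ≤ (32C_ψ²/ε)‖∇g‖²` (Markov). This `L²` phase selection replaces the
  `W^{1,∞}` bootstrap of [cite: DrivasEtAl2022, Lemma 3.2, Claim p. 12], which needs Lipschitz
  data, and works for the `H²` data of Theorem 2.
* `DEIJ.sq_mul_integral_sq_partialDeriv_le` (**Lemma 3.2, quantitative**): with such a phase and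
  the sign making the cross term nonnegative, `‖∂_q(g∘Φ_b)‖² ≥ (bN)²(1 - 8ε)‖∂_p g‖²`.
* `DEIJ.sqrt_integral_hess_comp_stage_le` (**Lemma 3.4, inviscid part**):
  `‖hess(g∘Φ_b)‖_{L²} ≤ (1 + bN)²‖hess g‖_{L²} + bN²(32C_ψ²‖∇g‖²/ε)^{1/2}`.
* bookkeeping of the undriven directions: `DEIJ.scalarGradNormSq_comp_shearMap_sub` (the rest
  `‖∇·‖² - ‖∂_q·‖²` is conserved), `DEIJ.integral_sq_partialDeriv_le_scalarGradNormSq_comp`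
  (the source `‖∂_p g‖²` survives), `DEIJ.scalarGradNormSq_comp_shearMap_le`.

## References

* [DrivasEtAl2022] T. D. Drivas, T. M. Elgindi, G. Iyer, I.-J. Jeong, *Anomalous dissipation in
  passive scalar transport*, Arch. Ration. Mech. Anal. 243 (2022), arXiv:1911.03271, §3.1–3.3,
  Lemmas 3.2 and 3.4.
-/

noncomputable section

open MeasureTheory TopologicalSpace Set Function Filter Topology UnitAddTorus
open scoped ENNReal NNReal InnerProductSpace ContDiff
open Literature.Analysis.FunctionSpaces.Torus
open Literature.Analysis.FunctionSpaces.Torus renaming partialDeriv → tPartialDeriv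

namespace Literature.Analysis.FluidPDE

namespace Torus

namespace DEIJ

variable {d : Type*} [Fintype d] [DecidableEq d]

/-! ## The slope wave on the circle and the derivatives of the stage profile -/

section SlopeProfile

/-- The slope wave `w_ε` as a smooth `1`-periodic profile. [folklore] -/
def slopeProfile (ε : ℝ) (hε : 0 < ε) (hε' : ε ≤ 1 / 16) : ShearProfile :=
  ⟨slopeWave ε, slopeWave_periodic ε, contDiff_slopeWave hε hε'⟩

/-- Values of the slope profile. [folklore] -/
@[simp]
theorem slopeProfile_apply {ε : ℝ} (hε : 0 < ε) (hε' : ε ≤ 1 / 16) (t : ℝ) :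
    slopeProfile ε hε hε' t = slopeWave ε t := rfl

/-- Values of the derived slope profile. [folklore] -/
@[simp]
theorem slopeProfile_D_apply {ε : ℝ} (hε : 0 < ε) (hε' : ε ≤ 1 / 16) (t : ℝ) :
    (slopeProfile ε hε hε').D t = deriv (slopeWave ε) t := rfl

/-- `|w_ε| ≤ 1` on the circle. [folklore] -/
theorem abs_onCircle_slopeProfile_le {ε : ℝ} (hε : 0 < ε) (hε' : ε ≤ 1 / 16) (z : UnitAddCircle) :
    |(slopeProfile ε hε hε').onCircle z| ≤ 1 := by
  induction z using QuotientAddGroup.induction_on with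
  | H t => rw [ShearProfile.onCircle_coe, slopeProfile_apply]; exact abs_slopeWave_le hε hε' t

/-- `0 ≤ 1 - w_ε² ≤ 1` on the circle. [folklore] -/
theorem one_sub_onCircle_slopeProfile_sq_mem {ε : ℝ} (hε : 0 < ε) (hε' : ε ≤ 1 / 16) (z : UnitAddCircle) :
    1 - (slopeProfile ε hε hε').onCircle z ^ 2 ∈ Icc (0 : ℝ) 1 := by
  induction z using QuotientAddGroup.induction_on with
  | H t => rw [ShearProfile.onCircle_coe, slopeProfile_apply]; exact one_sub_slopeWave_sq_mem hε hε' t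

/-- `|w_ε'| ≤ 2C_ψ/ε` on the circle. [folklore] -/
theorem abs_onCircle_slopeProfile_D_le {ε : ℝ} (hε : 0 < ε) (hε' : ε ≤ 1 / 16) (z : UnitAddCircle) :
    |(slopeProfile ε hε hε').D.onCircle z| ≤ 2 * ShearCascade.Cψ1 / ε := by
  induction z using QuotientAddGroup.induction_on with
  | H t => rw [ShearProfile.onCircle_coe, slopeProfile_D_apply]; exact abs_deriv_slopeWave_le hε hε' t

/-- The real number `N t + ϑ` projects to `N • t̄ + ϑ̄` on the circle. [folklore] -/
theorem coe_nat_mul_add (N : ℕ) (t ϑ : ℝ) :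
    ((N * t + ϑ : ℝ) : UnitAddCircle) = N • (t : UnitAddCircle) + (ϑ : UnitAddCircle) := by
  rw [← nsmul_eq_mul]; rfl

/-- The derivative of a scaled profile. [folklore] -/
theorem deriv_amp (P : ShearProfile) (c t : ℝ) : deriv (ShearStage.amp P c) t = c * deriv P t := by
  have e : (ShearStage.amp P c : ℝ → ℝ) = fun t => c * P t := rfl
  rw [e, deriv_const_mul _ ((P.contDiff.differentiable (by simp)).differentiableAt)]

/-- The derived profile of a scaled profile, on the circle. [folklore] -/
theorem onCircle_D_amp (P : ShearProfile) (c : ℝ) (z : UnitAddCircle) :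
    (ShearStage.amp P c).D.onCircle z = c * P.D.onCircle z := by
  induction z using QuotientAddGroup.induction_on with
  | H t => rw [ShearProfile.onCircle_coe, ShearProfile.onCircle_coe, ShearProfile.D_apply, ShearProfile.D_apply, deriv_amp]

/-- The second derived profile of a scaled profile, on the circle. [folklore] -/
theorem onCircle_D_D_amp (P : ShearProfile) (c : ℝ) (z : UnitAddCircle) :
    (ShearStage.amp P c).D.D.onCircle z = c * P.D.D.onCircle z := by
  induction z using QuotientAddGroup.induction_on with
  | H t =>
    rw [ShearProfile.onCircle_coe, ShearProfile.onCircle_coe, ShearProfile.D_apply, ShearProfile.D_apply,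
      ShearProfile.coe_D, ShearProfile.coe_D]
    have e : deriv (ShearStage.amp P c) = fun t => c * deriv P t := funext (deriv_amp P c)
    have hd : DifferentiableAt ℝ (deriv P) t := (P.D.contDiff.differentiable (by simp)).differentiableAt
    rw [e, deriv_const_mul _ hd]

/-- A uniform slope bound scales. [folklore] -/
theorem abs_deriv_amp_le {P : ShearProfile} {K : ℝ} (hK : ∀ t, |deriv P t| ≤ K) {c : ℝ} (t : ℝ) :
    |deriv (ShearStage.amp P c) t| ≤ |c| * K := by
  rw [deriv_amp, abs_mul]
  exact mul_le_mul_of_nonneg_left (hK t) (abs_nonneg _)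

/-- **The slope of the stage profile on the circle**: `(c S_ε(N· + ϑ))'(z) = c N w_ε(N • z + ϑ)`. [folklore] -/
theorem onCircle_D_stageProfile {ε : ℝ} (hε : 0 < ε) (hε' : ε ≤ 1 / 16) (N : ℕ) (c ϑ : ℝ) (z : UnitAddCircle) :
    (stageProfile ε hε hε' N c ϑ).D.onCircle z =
      c * N * (slopeProfile ε hε hε').onCircle (N • z + (ϑ : UnitAddCircle)) := by
  induction z using QuotientAddGroup.induction_on with
  | H t =>
    rw [← coe_nat_mul_add, ShearProfile.onCircle_coe, ShearProfile.onCircle_coe, ShearProfile.D_apply,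
      deriv_stageProfile hε hε', slopeProfile_apply]
    ring

/-- **The curvature of the stage profile on the circle**:
`(c S_ε(N· + ϑ))''(z) = c N² w_ε'(N • z + ϑ)`. [folklore] -/
theorem onCircle_D_D_stageProfile {ε : ℝ} (hε : 0 < ε) (hε' : ε ≤ 1 / 16) (N : ℕ) (c ϑ : ℝ) (z : UnitAddCircle) :
    (stageProfile ε hε hε' N c ϑ).D.D.onCircle z =
      c * N ^ 2 * (slopeProfile ε hε hε').D.onCircle (N • z + (ϑ : UnitAddCircle)) := by
  induction z using QuotientAddGroup.induction_on with
  | H t =>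
    rw [← coe_nat_mul_add, ShearProfile.onCircle_coe, ShearProfile.onCircle_coe, ShearProfile.D_apply,
      ShearProfile.coe_D, deriv_deriv_stageProfile hε hε', slopeProfile_D_apply]
    ring

end SlopeProfile

/-! ## Phase averaging -/

section PhaseAverage

omit [DecidableEq d] in
/-- **Phase averaging.** For a continuous `F` on the circle, a continuous weight `ρ` on `T^d`,
`N ∈ ℕ` and a coordinate `q`: `∫_{ϑ ∈ T¹} ∫_x F(N x_q + ϑ) ρ(x) = (∫_{T¹} F) (∫ ρ)` (Fubini and the
translation invariance of the Haar measure of `T¹`). [folklore] -/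
theorem integral_integral_comp_nsmul_add_mul {F : UnitAddCircle → ℝ} (hF : Continuous F) (N : ℕ) (q : d)
    {ρ : UnitAddTorus d → ℝ} (hρ : Continuous ρ) :
    ∫ ϑ : UnitAddCircle, ∫ x : UnitAddTorus d, F (N • x q + ϑ) * ρ x =
      (∫ ϑ : UnitAddCircle, F ϑ) * ∫ x, ρ x := by
  have hsh : Continuous fun z : UnitAddCircle × UnitAddTorus d => N • z.2 q + z.1 := by fun_prop
  have hK : Continuous fun z : UnitAddCircle × UnitAddTorus d => F (N • z.2 q + z.1) * ρ z.2 :=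
    (hF.comp hsh).mul (hρ.comp continuous_snd)
  have hI : Integrable (uncurry fun (ϑ : UnitAddCircle) (x : UnitAddTorus d) => F (N • x q + ϑ) * ρ x)
      ((volume : Measure UnitAddCircle).prod (volume : Measure (UnitAddTorus d))) :=
    hK.integrable_of_hasCompactSupport (HasCompactSupport.of_compactSpace _)
  rw [integral_integral_swap hI]
  have hin : ∀ x : UnitAddTorus d, ∫ ϑ : UnitAddCircle, F (N • x q + ϑ) * ρ x = (∫ ϑ : UnitAddCircle, F ϑ) * ρ x := by
    intro x
    rw [integral_mul_const, integral_add_left_eq_self]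
  simp_rw [hin]
  exact integral_const_mul _ _

/-- The Haar integral over `T¹` of a periodic lift is the period integral. [folklore] -/
theorem integral_onCircle_eq_intervalIntegral (P : ShearProfile) (G : ℝ → ℝ) :
    ∫ z : UnitAddCircle, G (P.onCircle z) = ∫ t in (0 : ℝ)..1, G (P t) := by
  rw [← AddCircle.intervalIntegral_preimage 1 0 (fun z => G (P.onCircle z)), zero_add]
  refine intervalIntegral.integral_congr fun t _ => ?_
  simp only [ShearProfile.onCircle_coe]

/-- **Mean corner defect over the phases**: `∫_{T¹} (1 - w_ε²) ≤ 4ε`. [folklore] -/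
theorem integral_one_sub_onCircle_slopeProfile_sq_le {ε : ℝ} (hε : 0 < ε) (hε' : ε ≤ 1 / 16) :
    ∫ z : UnitAddCircle, (1 - (slopeProfile ε hε hε').onCircle z ^ 2) ≤ 4 * ε := by
  rw [integral_onCircle_eq_intervalIntegral (slopeProfile ε hε hε') (fun v => 1 - v ^ 2)]
  exact intervalIntegral_one_sub_slopeWave_sq_le hε hε'

/-- **Mean squared curvature over the phases**: `∫_{T¹} (w_ε')² ≤ 16 C_ψ²/ε`. [folklore] -/
theorem integral_onCircle_slopeProfile_D_sq_le {ε : ℝ} (hε : 0 < ε) (hε' : ε ≤ 1 / 16) :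
    ∫ z : UnitAddCircle, (slopeProfile ε hε hε').D.onCircle z ^ 2 ≤ 16 * ShearCascade.Cψ1 ^ 2 / ε := by
  rw [integral_onCircle_eq_intervalIntegral (slopeProfile ε hε hε').D (fun v => v ^ 2)]
  exact intervalIntegral_deriv_slopeWave_sq_le hε hε'

variable {p q : d} {g : UnitAddTorus d → ℝ}

/-- The corner defect functional `A₁(ϑ) = ∫ (1 - w_ε(N x_q + ϑ)²)(∂_p g)²` is between `0` and
`∫ (∂_p g)²`. [folklore] -/
theorem defect_mem {ε : ℝ} (hε : 0 < ε) (hε' : ε ≤ 1 / 16) (hg : IsSmooth g) (N : ℕ) (ϑ : UnitAddCircle) :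
    ∫ x, (1 - (slopeProfile ε hε hε').onCircle (N • x q + ϑ) ^ 2) * tPartialDeriv p g x ^ 2 ∈
      Icc 0 (∫ x, tPartialDeriv p g x ^ 2) := by
  have hA : Continuous fun x => tPartialDeriv p g x := (hg.partialDeriv p).continuous
  constructor
  · exact integral_nonneg fun x => mul_nonneg (one_sub_onCircle_slopeProfile_sq_mem hε hε' _).1 (sq_nonneg _)
  · refine integral_mono_of_nonneg (Eventually.of_forall fun x =>
      mul_nonneg (one_sub_onCircle_slopeProfile_sq_mem hε hε' _).1 (sq_nonneg _)) (hA.pow 2).integrable_unitAddTorus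
      (Eventually.of_forall fun x => ?_)
    have h := (one_sub_onCircle_slopeProfile_sq_mem hε hε' (N • x q + ϑ)).2
    have h0 : 0 ≤ tPartialDeriv p g x ^ 2 := sq_nonneg _
    nlinarith

omit [DecidableEq d] in
/-- The curvature functional `A₂(ϑ) = ∫ w_ε'(N x_q + ϑ)² ‖∇g‖²` is between `0` and
`(2C_ψ/ε)² ∫ ‖∇g‖²`. [folklore] -/
theorem curv_mem {ε : ℝ} (hε : 0 < ε) (hε' : ε ≤ 1 / 16) (hg : IsSmooth g) (N : ℕ) (ϑ : UnitAddCircle) :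
    ∫ x, (slopeProfile ε hε hε').D.onCircle (N • x q + ϑ) ^ 2 * ‖gradient g x‖ ^ 2 ∈
      Icc 0 ((2 * ShearCascade.Cψ1 / ε) ^ 2 * ∫ x, ‖gradient g x‖ ^ 2) := by
  have hB : Continuous fun x => ‖gradient g x‖ := hg.gradient.continuous.norm
  constructor
  · exact integral_nonneg fun x => mul_nonneg (sq_nonneg _) (sq_nonneg _)
  · rw [← integral_const_mul]
    refine integral_mono_of_nonneg (Eventually.of_forall fun x => mul_nonneg (sq_nonneg _) (sq_nonneg _))
      (((hB.pow 2).integrable_unitAddTorus).const_mul _) (Eventually.of_forall fun x => ?_)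
    refine mul_le_mul_of_nonneg_right ?_ (sq_nonneg _)
    rw [← sq_abs]
    exact pow_le_pow_left₀ (abs_nonneg _) (abs_onCircle_slopeProfile_D_le hε hε' _) 2

/-- **Existence of a good phase.** For smooth `g`, there is a phase `ϑ` for which simultaneously the
corner defect `∫(1 - w_ε(N x_q + ϑ)²)(∂_p g)²` is at most `8ε ∫(∂_p g)²` and the curvature weight
`∫ w_ε'(N x_q + ϑ)²‖∇g‖²` is at most `(32 C_ψ²/ε) ∫‖∇g‖²` (both hold on phase-average up to a factor
`2`, by `integral_integral_comp_nsmul_add_mul`; Markov). This replaces the `W^{1,∞}` bootstrap of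
[cite: DrivasEtAl2022, Lemma 3.2, Claim p. 12] by an `L²` argument. [folklore] -/
theorem exists_good_phase {ε : ℝ} (hε : 0 < ε) (hε' : ε ≤ 1 / 16) (hg : IsSmooth g) (N : ℕ) (p q : d) :
    ∃ ϑ : ℝ,
      ∫ x, (1 - (slopeProfile ε hε hε').onCircle (N • x q + (ϑ : UnitAddCircle)) ^ 2) * tPartialDeriv p g x ^ 2 ≤
          8 * ε * ∫ x, tPartialDeriv p g x ^ 2 ∧
        ∫ x, (slopeProfile ε hε hε').D.onCircle (N • x q + (ϑ : UnitAddCircle)) ^ 2 * ‖gradient g x‖ ^ 2 ≤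
          32 * ShearCascade.Cψ1 ^ 2 / ε * ∫ x, ‖gradient g x‖ ^ 2 := by
  obtain ⟨hC0, -⟩ := ShearCascade.Cψ1_spec
  have hε0 : ε ≠ 0 := hε.ne'
  set Pw := slopeProfile ε hε hε' with hPw
  set a : ℝ := ∫ x, tPartialDeriv p g x ^ 2 with ha
  set P : ℝ := ∫ x, ‖gradient g x‖ ^ 2 with hP
  set M₂ : ℝ := 32 * ShearCascade.Cψ1 ^ 2 / ε * P with hM₂
  set A₁ : UnitAddCircle → ℝ := fun ϑ => ∫ x, (1 - Pw.onCircle (N • x q + ϑ) ^ 2) * tPartialDeriv p g x ^ 2 with hA₁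
  set A₂ : UnitAddCircle → ℝ := fun ϑ => ∫ x, Pw.D.onCircle (N • x q + ϑ) ^ 2 * ‖gradient g x‖ ^ 2 with hA₂
  have ha0 : 0 ≤ a := integral_nonneg fun x => sq_nonneg _
  have hP0 : 0 ≤ P := integral_nonneg fun x => sq_nonneg _
  have hM0 : 0 ≤ M₂ := by positivity
  have hcA : Continuous fun x => tPartialDeriv p g x := (hg.partialDeriv p).continuous
  have hcB : Continuous fun x => ‖gradient g x‖ := hg.gradient.continuous.norm
  have hcA2 : Continuous fun x => tPartialDeriv p g x ^ 2 := hcA.pow 2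
  have hcB2 : Continuous fun x => ‖gradient g x‖ ^ 2 := hcB.pow 2
  have hsh : Continuous fun z : UnitAddCircle × UnitAddTorus d => N • z.2 q + z.1 := by fun_prop
  have hF1 : Continuous fun z : UnitAddCircle => 1 - Pw.onCircle z ^ 2 :=
    continuous_const.sub (Pw.continuous_onCircle.pow 2)
  have hF2 : Continuous fun z : UnitAddCircle => Pw.D.onCircle z ^ 2 := Pw.D.continuous_onCircle.pow 2
  -- the phase averages
  have hm1 : ∫ ϑ, A₁ ϑ ≤ 4 * ε * a := by
    simp only [hA₁]
    rw [integral_integral_comp_nsmul_add_mul hF1 N q hcA2]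
    exact mul_le_mul_of_nonneg_right (integral_one_sub_onCircle_slopeProfile_sq_le hε hε') ha0
  have hm2 : ∫ ϑ, A₂ ϑ ≤ 16 * ShearCascade.Cψ1 ^ 2 / ε * P := by
    simp only [hA₂]
    rw [integral_integral_comp_nsmul_add_mul hF2 N q hcB2]
    exact mul_le_mul_of_nonneg_right (integral_onCircle_slopeProfile_D_sq_le hε hε') hP0
  -- integrability of the phase functionals (Fubini)
  have hK1 : Continuous fun z : UnitAddCircle × UnitAddTorus d =>
      (1 - Pw.onCircle (N • z.2 q + z.1) ^ 2) * tPartialDeriv p g z.2 ^ 2 :=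
    (hF1.comp hsh).mul (hcA2.comp continuous_snd)
  have hK2 : Continuous fun z : UnitAddCircle × UnitAddTorus d =>
      Pw.D.onCircle (N • z.2 q + z.1) ^ 2 * ‖gradient g z.2‖ ^ 2 :=
    (hF2.comp hsh).mul (hcB2.comp continuous_snd)
  have hi1 : Integrable A₁ (volume : Measure UnitAddCircle) := by
    have h := (hK1.integrable_of_hasCompactSupport (μ := (volume : Measure UnitAddCircle).prod
      (volume : Measure (UnitAddTorus d))) (HasCompactSupport.of_compactSpace _)).integral_prod_left
    simpa [hA₁] using h
  have hi2 : Integrable A₂ (volume : Measure UnitAddCircle) := by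
    have h := (hK2.integrable_of_hasCompactSupport (μ := (volume : Measure UnitAddCircle).prod
      (volume : Measure (UnitAddTorus d))) (HasCompactSupport.of_compactSpace _)).integral_prod_left
    simpa [hA₂] using h
  -- Markov for `Ψ = A₁/(8εa) + A₂/M₂`
  set Ψ : UnitAddCircle → ℝ := fun ϑ => A₁ ϑ / (8 * ε * a) + A₂ ϑ / M₂ with hΨ
  have hiΨ : Integrable Ψ (volume : Measure UnitAddCircle) := (hi1.div_const _).add (hi2.div_const _)
  have hmΨ : ∫ ϑ, Ψ ϑ ≤ 1 := by
    simp only [hΨ]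
    rw [integral_add (hi1.div_const _) (hi2.div_const _), integral_div, integral_div]
    have h1 : (∫ ϑ, A₁ ϑ) / (8 * ε * a) ≤ 1 / 2 := by
      rcases eq_or_lt_of_le ha0 with h | h
      · rw [← h, mul_zero, div_zero]; norm_num
      · rw [div_le_iff₀ (by positivity)]
        have e : 1 / 2 * (8 * ε * a) = 4 * ε * a := by ring
        rw [e]; exact hm1
    have h2 : (∫ ϑ, A₂ ϑ) / M₂ ≤ 1 / 2 := by
      rcases eq_or_lt_of_le hM0 with h | h
      · rw [← h, div_zero]; norm_num
      · rw [div_le_iff₀ h]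
        have e : 1 / 2 * M₂ = 16 * ShearCascade.Cψ1 ^ 2 / ε * P := by simp only [hM₂]; ring
        rw [e]; exact hm2
    linarith
  obtain ⟨ϑc, hϑc⟩ := exists_le_integral hiΨ
  obtain ⟨ϑ, rfl⟩ := QuotientAddGroup.mk_surjective ϑc
  have hΨ1 : Ψ ϑ ≤ 1 := hϑc.trans hmΨ
  have hA1m := defect_mem (p := p) (q := q) hε hε' hg N (ϑ : UnitAddCircle)
  have hA2m := curv_mem (q := q) hε hε' hg N (ϑ : UnitAddCircle)
  have hA10 : 0 ≤ A₁ ϑ := hA1m.1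
  have hA20 : 0 ≤ A₂ ϑ := hA2m.1
  have ht1 : A₁ ϑ / (8 * ε * a) ≤ 1 := by
    have : 0 ≤ A₂ ϑ / M₂ := div_nonneg hA20 hM0
    simp only [hΨ] at hΨ1; linarith
  have ht2 : A₂ ϑ / M₂ ≤ 1 := by
    have : 0 ≤ A₁ ϑ / (8 * ε * a) := div_nonneg hA10 (by positivity)
    simp only [hΨ] at hΨ1; linarith
  refine ⟨ϑ, ?_, ?_⟩
  · show A₁ ϑ ≤ 8 * ε * a
    rcases eq_or_lt_of_le ha0 with h | h
    · have h' : A₁ ϑ ≤ a := hA1m.2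
      rw [← h] at h' ⊢
      simpa using h'
    · rwa [div_le_iff₀ (by positivity), one_mul] at ht1
  · show A₂ ϑ ≤ M₂
    rcases eq_or_lt_of_le hM0 with h | h
    · -- `M₂ = 0`: then `C_ψ² P = 0` and the crude bound vanishes too
      have hcr : A₂ ϑ ≤ (2 * ShearCascade.Cψ1 / ε) ^ 2 * P := hA2m.2
      have e : (2 * ShearCascade.Cψ1 / ε) ^ 2 * P = M₂ / (8 * ε) := by
        simp only [hM₂]; field_simp; ring
      rw [e, ← h, zero_div] at hcr
      rw [← h]; exact hcr
    · rwa [div_le_iff₀ h, one_mul] at ht2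

end PhaseAverage

/-! ## The growth inequalities of one stage -/

section StageStep

variable {p q : d} {g : UnitAddTorus d → ℝ}

/-- The slope of the scaled stage profile is at most `|b| N` (for a unit sign `|s| = 1`). [folklore] -/
theorem abs_deriv_amp_stageProfile_le {ε : ℝ} (hε : 0 < ε) (hε' : ε ≤ 1 / 16) (N : ℕ) {s : ℝ}
    (hs : s = 1 ∨ s = -1) (ϑ b t : ℝ) :
    |deriv (ShearStage.amp (stageProfile ε hε hε' N s ϑ) b) t| ≤ |b| * N := by
  have h1 : |s| = 1 := by rcases hs with h | h <;> simp [h]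
  have h := abs_deriv_amp_le (c := b) (fun t => abs_deriv_stageProfile_le hε hε' N s ϑ t) t
  rwa [h1, one_mul] at h

/-- **Growth of the driven derivative (DEIJ Lemma 3.2, quantitative, any dimension).** Shear the
smooth scalar `g` by `Φ(x) = x - b s S_ε(N x_q + ϑ) e_p` with `b ≥ 0`, a sign `s = ±1` making the
cross term `-2 b s N ∫ w_ε(N x_q + ϑ) ∂_q g ∂_p g` nonnegative, and a phase `ϑ` whose corner defect
is at most `8ε ∫(∂_p g)²`. Then `‖∂_q(g ∘ Φ)‖²_{L²} ≥ (bN)² (1 - 8ε) ‖∂_p g‖²_{L²}`.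
[cite: DrivasEtAl2022, Lemma 3.2 (3.4) and its proof, pp. 11–12] -/
theorem sq_mul_integral_sq_partialDeriv_le {ε : ℝ} (hε : 0 < ε) (hε' : ε ≤ 1 / 16) (hg : IsSmooth g)
    (hpq : p ≠ q) (N : ℕ) {ϑ s b : ℝ} (hs : s = 1 ∨ s = -1) (hb : 0 ≤ b)
    (hsX : s * ∫ x, (slopeProfile ε hε hε').onCircle (N • x q + (ϑ : UnitAddCircle)) *
        (tPartialDeriv q g x * tPartialDeriv p g x) ≤ 0)
    (hA₁ : ∫ x, (1 - (slopeProfile ε hε hε').onCircle (N • x q + (ϑ : UnitAddCircle)) ^ 2) *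
        tPartialDeriv p g x ^ 2 ≤ 8 * ε * ∫ x, tPartialDeriv p g x ^ 2) :
    (b * N) ^ 2 * (1 - 8 * ε) * ∫ x, tPartialDeriv p g x ^ 2 ≤
      ∫ x, tPartialDeriv q (g ∘ shearMap p q (ShearStage.amp (stageProfile ε hε hε' N s ϑ) b)) x ^ 2 := by
  set Pw := slopeProfile ε hε hε' with hPw
  set Φ := ShearStage.amp (stageProfile ε hε hε' N s ϑ) b with hΦ
  have hs2 : s ^ 2 = 1 := by rcases hs with h | h <;> simp [h]
  have hD : ∀ x : UnitAddTorus d, Φ.D.onCircle (x q) = b * (s * N) * Pw.onCircle (N • x q + ϑ) := fun x => by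
    rw [hΦ, onCircle_D_amp, onCircle_D_stageProfile]; ring
  have hcA : Continuous fun x => tPartialDeriv p g x := (hg.partialDeriv p).continuous
  have hcW : Continuous fun x : UnitAddTorus d => Pw.onCircle (N • x q + ϑ) :=
    Pw.continuous_onCircle.comp (((continuous_apply q).nsmul N).add continuous_const)
  rw [integral_sq_partialDeriv_comp_shearMap_same hg hpq Φ]
  have hcross : ∫ x, Φ.D.onCircle (x q) * (tPartialDeriv q g x * tPartialDeriv p g x) =
      b * (s * N) * ∫ x, Pw.onCircle (N • x q + ϑ) * (tPartialDeriv q g x * tPartialDeriv p g x) := by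
    rw [← integral_const_mul]
    refine integral_congr_ae (Eventually.of_forall fun x => ?_)
    simp only [hD]; ring
  have I1 : Integrable (fun x => tPartialDeriv p g x ^ 2) volume := (hcA.pow 2).integrable_unitAddTorus
  have I2 : Integrable (fun x => (1 - Pw.onCircle (N • x q + ϑ) ^ 2) * tPartialDeriv p g x ^ 2) volume :=
    ((continuous_const.sub (hcW.pow 2)).mul (hcA.pow 2)).integrable_unitAddTorus
  have hsq : ∫ x, Φ.D.onCircle (x q) ^ 2 * tPartialDeriv p g x ^ 2 =
      (b * N) ^ 2 * ((∫ x, tPartialDeriv p g x ^ 2) -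
        ∫ x, (1 - Pw.onCircle (N • x q + ϑ) ^ 2) * tPartialDeriv p g x ^ 2) := by
    rw [← integral_sub I1 I2, ← integral_const_mul]
    refine integral_congr_ae (Eventually.of_forall fun x => ?_)
    simp only [hD]
    have e : (b * (s * N) * Pw.onCircle (N • x q + ϑ)) ^ 2 =
        (b * N) ^ 2 * s ^ 2 * Pw.onCircle (N • x q + ϑ) ^ 2 := by ring
    rw [e, hs2]; ring
  rw [hcross, hsq]
  have h0 : 0 ≤ ∫ x, tPartialDeriv q g x ^ 2 := integral_nonneg fun x => sq_nonneg _
  have hN : (0 : ℝ) ≤ N := Nat.cast_nonneg N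
  nlinarith [mul_nonneg hb hN, sq_nonneg (b * N), hsX, hA₁]

/-- **Growth of the Hessian in one stage (DEIJ Lemma 3.4, inviscid part, any dimension).** With a
phase whose curvature weight is at most `(32C_ψ²/ε)‖∇g‖²`:
`‖hess(g∘Φ)‖_{L²} ≤ (1 + bN)² ‖hess g‖_{L²} + b N² (32 C_ψ² ‖∇g‖²_{L²}/ε)^{1/2}`.
[cite: DrivasEtAl2022, Lemma 3.4, p. 13] -/
theorem sqrt_integral_hess_comp_stage_le {ε : ℝ} (hε : 0 < ε) (hε' : ε ≤ 1 / 16) (hg : IsSmooth g)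
    (hpq : p ≠ q) (N : ℕ) {ϑ s b : ℝ} (hs : s = 1 ∨ s = -1) (hb : 0 ≤ b)
    (hA₂ : ∫ x, (slopeProfile ε hε hε').D.onCircle (N • x q + (ϑ : UnitAddCircle)) ^ 2 * ‖gradient g x‖ ^ 2 ≤
        32 * ShearCascade.Cψ1 ^ 2 / ε * ∫ x, ‖gradient g x‖ ^ 2) :
    Real.sqrt (∫ x, ‖hess (g ∘ shearMap p q (ShearStage.amp (stageProfile ε hε hε' N s ϑ) b)) x‖ ^ 2) ≤
      (1 + b * N) ^ 2 * Real.sqrt (∫ x, ‖hess g x‖ ^ 2) +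
        b * N ^ 2 * Real.sqrt (32 * ShearCascade.Cψ1 ^ 2 / ε * ∫ x, ‖gradient g x‖ ^ 2) := by
  set Pw := slopeProfile ε hε hε' with hPw
  set Φ := ShearStage.amp (stageProfile ε hε hε' N s ϑ) b with hΦ
  have hs2 : s ^ 2 = 1 := by rcases hs with h | h <;> simp [h]
  have hK : ∀ t, |deriv Φ t| ≤ b * N := fun t => by
    have h := abs_deriv_amp_stageProfile_le hε hε' N hs ϑ b t
    rwa [abs_of_nonneg hb] at h
  refine (sqrt_integral_hess_comp_shearMap_le hg hpq Φ hK).trans (add_le_add le_rfl ?_)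
  have hDD : ∀ x : UnitAddTorus d, Φ.D.D.onCircle (x q) = b * (s * N ^ 2) * Pw.D.onCircle (N • x q + ϑ) := fun x => by
    rw [hΦ, onCircle_D_D_amp, onCircle_D_D_stageProfile]; ring
  have e : ∫ x, Φ.D.D.onCircle (x q) ^ 2 * ‖gradient g x‖ ^ 2 =
      (b * N ^ 2) ^ 2 * ∫ x, Pw.D.onCircle (N • x q + ϑ) ^ 2 * ‖gradient g x‖ ^ 2 := by
    rw [← integral_const_mul]
    refine integral_congr_ae (Eventually.of_forall fun x => ?_)
    simp only [hDD]
    have e1 : (b * (s * N ^ 2) * Pw.D.onCircle (N • x q + ϑ)) ^ 2 =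
        (b * N ^ 2) ^ 2 * s ^ 2 * Pw.D.onCircle (N • x q + ϑ) ^ 2 := by ring
    rw [e1, hs2]; ring
  rw [e]
  have hbN : 0 ≤ b * N ^ 2 := by positivity
  calc Real.sqrt ((b * N ^ 2) ^ 2 * ∫ x, Pw.D.onCircle (N • x q + ϑ) ^ 2 * ‖gradient g x‖ ^ 2)
      ≤ Real.sqrt ((b * N ^ 2) ^ 2 * (32 * ShearCascade.Cψ1 ^ 2 / ε * ∫ x, ‖gradient g x‖ ^ 2)) :=
        Real.sqrt_le_sqrt (mul_le_mul_of_nonneg_left hA₂ (sq_nonneg _))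
    _ = b * N ^ 2 * Real.sqrt (32 * ShearCascade.Cψ1 ^ 2 / ε * ∫ x, ‖gradient g x‖ ^ 2) := by
        rw [Real.sqrt_mul' _ (by
          exact mul_nonneg (by positivity) (integral_nonneg fun x => sq_nonneg _)), Real.sqrt_sq hbN]

/-- **The undriven derivatives keep their `L²` norms**, summed: the "rest"
`Σ_{r ≠ q} ‖∂_r(g∘Φ)‖²` equals `Σ_{r ≠ q} ‖∂_r g‖²`. [folklore] -/
theorem sum_erase_integral_sq_partialDeriv_comp_shearMap (hg : IsSmooth g) (hpq : p ≠ q) (P : ShearProfile) :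
    ∑ r ∈ Finset.univ.erase q, ∫ x, tPartialDeriv r (g ∘ shearMap p q P) x ^ 2 =
      ∑ r ∈ Finset.univ.erase q, ∫ x, tPartialDeriv r g x ^ 2 :=
  Finset.sum_congr rfl fun _ hr =>
    integral_sq_partialDeriv_comp_shearMap_of_ne hg hpq P (Finset.ne_of_mem_erase hr)

/-- `‖∇g‖²_{L²} = ‖∂_q g‖² + Σ_{r ≠ q} ‖∂_r g‖²`. [folklore] -/
theorem scalarGradNormSq_eq_add_sum_erase (hg : IsSmooth g) (q : d) :
    scalarGradNormSq g = (∫ x, tPartialDeriv q g x ^ 2) + ∑ r ∈ Finset.univ.erase q, ∫ x, tPartialDeriv r g x ^ 2 := by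
  rw [scalarGradNormSq_eq_sum_integral hg, ← Finset.add_sum_erase _ _ (Finset.mem_univ q)]

/-- **The rest is conserved**: `‖∇(g∘Φ)‖² - ‖∂_q(g∘Φ)‖² = ‖∇g‖² - ‖∂_q g‖²`. [folklore] -/
theorem scalarGradNormSq_comp_shearMap_sub (hg : IsSmooth g) (hpq : p ≠ q) (P : ShearProfile) :
    scalarGradNormSq (g ∘ shearMap p q P) - ∫ x, tPartialDeriv q (g ∘ shearMap p q P) x ^ 2 =
      scalarGradNormSq g - ∫ x, tPartialDeriv q g x ^ 2 := by
  rw [scalarGradNormSq_eq_add_sum_erase (hg.comp_shearMap p q P) q, scalarGradNormSq_eq_add_sum_erase hg q,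
    sum_erase_integral_sq_partialDeriv_comp_shearMap hg hpq P]
  ring

/-- A single direction is at most the whole gradient: `‖∂_r g‖² ≤ ‖∇g‖²`. [folklore] -/
theorem integral_sq_partialDeriv_le_scalarGradNormSq (hg : IsSmooth g) (r : d) :
    ∫ x, tPartialDeriv r g x ^ 2 ≤ scalarGradNormSq g := by
  rw [scalarGradNormSq_eq_sum_integral hg]
  exact Finset.single_le_sum (f := fun i => ∫ x, tPartialDeriv i g x ^ 2)
    (fun i _ => integral_nonneg fun x => sq_nonneg _) (Finset.mem_univ r)

/-- **The source survives the stage**: `‖∇(g∘Φ)‖² ≥ ‖∂_p g‖²` (the direction `p ≠ q` is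
undriven). [folklore] -/
theorem integral_sq_partialDeriv_le_scalarGradNormSq_comp (hg : IsSmooth g) (hpq : p ≠ q) (P : ShearProfile) :
    ∫ x, tPartialDeriv p g x ^ 2 ≤ scalarGradNormSq (g ∘ shearMap p q P) := by
  rw [← integral_sq_partialDeriv_comp_shearMap_of_ne hg hpq P hpq]
  exact integral_sq_partialDeriv_le_scalarGradNormSq (hg.comp_shearMap p q P) p

/-- The rest after the stage is at most the whole gradient before:
`‖∇(g∘Φ)‖² ≤ ‖∇g‖² + ‖∂_q(g∘Φ)‖²`. [folklore] -/
theorem scalarGradNormSq_comp_shearMap_le (hg : IsSmooth g) (hpq : p ≠ q) (P : ShearProfile) :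
    scalarGradNormSq (g ∘ shearMap p q P) ≤
      scalarGradNormSq g + ∫ x, tPartialDeriv q (g ∘ shearMap p q P) x ^ 2 := by
  have h := scalarGradNormSq_comp_shearMap_sub hg hpq P
  have h0 : 0 ≤ ∫ x, tPartialDeriv q g x ^ 2 := integral_nonneg fun x => sq_nonneg _
  linarith

/-- The driven direction is at most the whole gradient after the stage. [folklore] -/
theorem integral_sq_partialDeriv_comp_le_scalarGradNormSq (hg : IsSmooth g) (P : ShearProfile) :
    ∫ x, tPartialDeriv q (g ∘ shearMap p q P) x ^ 2 ≤ scalarGradNormSq (g ∘ shearMap p q P) :=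
  integral_sq_partialDeriv_le_scalarGradNormSq (hg.comp_shearMap p q P) q

end StageStep

end DEIJ

end Torus

end Literature.Analysis.FluidPDE
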